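import Mathlib
import HarnessLib
import Summits.Parity.GeneralizedHardyLittlewood.Theses.LeeYangFibres
import Literature.NumberTheory.Sieve.SingularSeries
import Literature.NumberTheory.Sieve.SingularSeriesMultiplesMean
import Literature.NumberTheory.LFunctions.RHWave0

/-!
# Crux `RelativeDimOne` (stmt-Parity-14113) — ideator 1, round 1: first lemmas of two idea cards

Card A `gallagher-backwards-split` : read Gallagher's identity
`∑_{a mod q} ψ(N;q,a)² = ∑_{n≤N} Λ(n)² + 2 ∑_{k≥1} S_N(qk)`, `S_N(h) = ∑_{n ≤ N-h} Λ(n)Λ(n+h)`,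
BACKWARDS: the crux (t = 2, slope (1,1), shifts `qk ≤ N`, `K = [1, N-qk]`) pins every lattice sum,
hence (positivity of `|ψ(N,χ)|²`) a sharp second moment of primes in classes for EVERY modulus
`q ≤ N` and the prime number theorem `ψ(N,χ) = o(N)` for EVERY non-principal character of
conductor `≤ N^{1-o(1)}` (necessity certificates `LatticeNecessity`, `CharacterNecessity`);
and the crux splits as (sharp class second moment) ∧ (Ramanujan-bandlimited pair correlations).

Card B `translate-amplification` : the complete-sum identity
`∑_H S(Ψ ⊔ (Ψ+H), K ∩ (K-H)) = S(Ψ,K)²` (and its m-fold version) plus Gallagher averaging of the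
singular products of translate-constellations turns two-sided ORDER-OF-MAGNITUDE bounds with
sub-exponential loss in the number of forms into the exact asymptotic: `CoarseHL → RelativeDimOne`.

Everything below is a DEFINITION of a Prop (statements only; nothing is claimed proved here)
except the one-line `translate_eval`.
-/

namespace Summit.Parity.GeneralizedHardyLittlewood.Cruxes.RelativeDimOne.SketchIdeator1

open Literature.NumberTheory.Sieve
open Summit.Parity.GeneralizedHardyLittlewood.Theses.LeeYangFibres (RelativeDimOne DimOne)
open scoped ArithmeticFunction.vonMangoldt
open Filter Topology

/-! ## Card A — Gallagher backwards -/

/-- `ψ(N; q, a) = ∑_{n ≤ N, n ≡ a (q)} Λ(n)` (all residues `a < q`, coprime or not). -/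
noncomputable def classPsi (N q a : ℕ) : ℝ :=
  ∑ n ∈ (Finset.Icc 1 N).filter (fun n => n % q = a), Λ n

/-- SHARP CLASS SECOND MOMENT (individual-modulus Barban–Davenport–Halberstam / ℓ²-Brun–Titchmarsh
with constant 1): for every modulus `1 ≤ q ≤ N`,
`∑_{a mod q} ψ(N;q,a)² ≤ (1+ε) (N²/φ(q) + N log N)` for `N ≥ N₀(ε)`.
Consequence of GRH; open unconditionally for `(log N)^A < q < N/(log N)^A`
(Siegel zeros for small `q`; zeros at `1 - C/log q` for `q = N^δ`; beyond `N^{1/2}` no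
`L`-function tool at all — there it is itself a thin average of prime-pair counts). -/
def SharpClassSecondMoment : Prop :=
  ∀ ε : ℝ, 0 < ε → ∃ N₀ : ℕ, ∀ N : ℕ, N₀ ≤ N → ∀ q : ℕ, 1 ≤ q → q ≤ N →
    ∑ a ∈ Finset.range q, classPsi N q a ^ 2 ≤
      (1 + ε) * ((N : ℝ) ^ 2 / Nat.totient q + N * Real.log N)

/-- `ψ(N, χ) = ∑_{n ≤ N} Λ(n) χ(n)`. -/
noncomputable def charPsi {q : ℕ} (χ : DirichletCharacter ℂ q) (N : ℕ) : ℂ :=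
  ∑ n ∈ Finset.Icc 1 N, (Λ n : ℂ) * χ (n : ZMod q)

/-- UNIFORM CHARACTER PNT up to conductor `N^θ`, every `θ < 1`: `|ψ(N,χ)| ≤ ε N` for every
non-principal `χ mod q`, `2 ≤ q ≤ N^θ`, `N ≥ N₀(θ, ε)`. Implied by GRH
(`Literature.NumberTheory.LFunctions.GeneralizedRiemannHypothesis`); implies
`Literature.NumberTheory.LFunctions.NoSiegelZeros`-type repulsion `(1-β) log N → ∞`; open. -/
def UniformCharPNT : Prop :=
  ∀ θ : ℝ, θ < 1 → ∀ ε : ℝ, 0 < ε → ∃ N₀ : ℕ, ∀ N : ℕ, N₀ ≤ N →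
    ∀ q : ℕ, 2 ≤ q → (q : ℝ) ≤ (N : ℝ) ^ θ →
      ∀ χ : DirichletCharacter ℂ q, χ ≠ 1 → ‖charPsi χ N‖ ≤ ε * N

/-- FIRST LEMMA A1 (necessity; provable now: RelativeDimOne at `t = 2`, `Ψ = (n, n + qk)`,
`K = [1, N - qk]`, summed over `k ≤ N/q`, with `sum_goldbachSingularSeries_mul_le` for the
lattice mean of `𝔖` and `chebyshevPsi_isEquivalent_holds` for the diagonal). -/
def LatticeNecessity : Prop := RelativeDimOne → SharpClassSecondMoment

/-- FIRST LEMMA A2 (orthogonality of characters + PNT for `χ₀`). -/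
def CharacterNecessity : Prop := SharpClassSecondMoment → UniformCharPNT

/-- The pair correlation `S_N(h) = ∑_{1 ≤ n ≤ N-h} Λ(n) Λ(n+h)`. -/
noncomputable def pairSum (N h : ℕ) : ℝ :=
  ∑ n ∈ Finset.Icc 1 (N - h), Λ n * Λ (n + h)

/-- Ramanujan's sum `c_q(h) = ∑_{(a,q)=1} cos(2π a h/q)` (real form). -/
noncomputable def ramanujanSum (q h : ℕ) : ℝ :=
  ∑ a ∈ (Finset.range q).filter (fun a => Nat.Coprime a q), Real.cos (2 * Real.pi * a * h / q)

/-- RAMANUJAN-BANDLIMITED PAIR CORRELATIONS at level `N^θ` (the binary core; existential in the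
spectrum `α`, hence blind to every conspiracy of primes in progressions to moduli `≤ N^θ`;
non-vacuous for `θ < 1/2` since the span has dimension `≍ N^{2θ} < N`). Under HL it holds with
`α(q) = μ²(q)/φ(q)²` for every `θ > 0`. -/
def PairBandlimited (θ : ℝ) : Prop :=
  ∀ ε : ℝ, 0 < ε → ∃ N₀ : ℕ, ∀ N : ℕ, N₀ ≤ N → ∃ α : ℕ → ℝ, ∀ h : ℕ, 1 ≤ h → h ≤ N →
    |pairSum N h - ((N : ℝ) - h) * ∑ q ∈ Finset.Icc 1 ⌊(N : ℝ) ^ θ⌋₊, α q * ramanujanSum q h|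
      ≤ ε * N

/-- The pair slice of the crux (`t = 2`, `Ψ = (n, n+h)`, `K = [1, N-h]`; `𝔖(h)` = the tree's
`goldbachSingularSeries`). -/
def RelDimOnePairs : Prop :=
  ∀ ε : ℝ, 0 < ε → ∃ N₀ : ℕ, ∀ N : ℕ, N₀ ≤ N → ∀ h : ℕ, 1 ≤ h → h ≤ N →
    |pairSum N h - ((N : ℝ) - h) * goldbachSingularSeries h| ≤
      ε * (((N : ℝ) - h) * goldbachSingularSeries h + N)

/-- THE SPLIT at pair level (claimed for `0 < θ < 1/2`; `→` is A1 plus the Ramanujan expansion of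
`𝔖`, `←` is Möbius/least-squares inversion of the lattice data using near-orthogonality of the
`c_q` on `[1, N]` for `q q' ≤ N`). -/
def PairSplit (θ : ℝ) : Prop := RelDimOnePairs ↔ (PairBandlimited θ ∧ SharpClassSecondMoment)

/-- The crux projects onto its pair slice (specialisation; provable now modulo the dictionary
`singularProduct (n, n+h) = goldbachSingularSeries h`, `archFactor = N - h - 1 + O(1)`). -/
def PairsOfRelative : Prop := RelativeDimOne → RelDimOnePairs

/-! ## Card B — amplification over translate-constellations -/

variable {t s : ℕ}

/-- Translate of a `d = 1` system by `H`: `(translate Ψ H) i (n) = ψ_i(n + H)`. -/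
def translate (Ψ : Fin t → AffLinForm 1) (H : ℤ) : Fin t → AffLinForm 1 :=
  fun i => ⟨(Ψ i).coeff, (Ψ i).const + (Ψ i).coeff 0 * H⟩

theorem translate_eval (Ψ : Fin t → AffLinForm 1) (H : ℤ) (i : Fin t) (n : Fin 1 → ℤ) :
    (translate Ψ H i).eval n = (Ψ i).eval (fun j => n j + H) := by
  simp [translate, AffLinForm.eval]
  ring

/-- Join (disjoint union) of two systems in the same variable. -/
def join (Ψ : Fin t → AffLinForm 1) (Φ : Fin s → AffLinForm 1) : Fin (t + s) → AffLinForm 1 :=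
  Fin.append Ψ Φ

/-- `K ∩ (K - H)`: the points `x` with `x ∈ K` and `x + H ∈ K`. -/
def meetTranslate (K : Set (Fin 1 → ℝ)) (H : ℤ) : Set (Fin 1 → ℝ) :=
  K ∩ {x | (fun j => x j + (H : ℝ)) ∈ K}

/-- FIRST LEMMA B1 — the complete-sum identity (`m = 1`): summing the von Mangoldt sums of the
translate-constellations `Ψ ⊔ (Ψ + H)` over ALL shifts `|H| ≤ 2N` gives exactly `S(Ψ, K)²`
(reindex `m = n + H`; elementary, provable now). -/
def CompleteSumIdentity : Prop :=
  ∀ (t N : ℕ) (Ψ : Fin t → AffLinForm 1) (K : Set (Fin 1 → ℝ)), K ⊆ realBox 1 N →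
    ∑ H ∈ Finset.Icc (-(2 * N : ℤ)) (2 * N),
        vonMangoldtSum (join Ψ (translate Ψ H)) (meetTranslate K H) N
      = vonMangoldtSum Ψ K N ^ 2

/-- `realPoint` of a translated lattice point. -/
theorem realPoint_add (n : Fin 1 → ℤ) (H : ℤ) :
    realPoint (fun j => n j + H) = fun j => realPoint n j + (H : ℝ) := by
  funext j
  simp [realPoint]

/-- The product of the weights over a joined system splits. -/
theorem prod_join (Ψ : Fin t → AffLinForm 1) (Φ : Fin s → AffLinForm 1) (n : Fin 1 → ℤ) :
    ∏ i, intVonMangoldt ((join Ψ Φ i).eval n) =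
      (∏ i, intVonMangoldt ((Ψ i).eval n)) * ∏ i, intVonMangoldt ((Φ i).eval n) := by
  rw [Fin.prod_univ_add]
  simp [join]

/-- **B1 holds**: the complete-sum identity, PROVED (double counting `m = n + H`). -/
theorem completeSumIdentity_holds : CompleteSumIdentity := by
  classical
  intro t N Ψ K hK
  set f : (Fin 1 → ℤ) → ℝ := fun n => ∏ i, intVonMangoldt ((Ψ i).eval n) with hf
  set B := (latticeBox 1 N).filter (fun n => realPoint n ∈ K) with hB
  -- membership in the box from membership of the real point in `K ⊆ [-N, N]`
  have hbox : ∀ m : Fin 1 → ℤ, realPoint m ∈ K → m ∈ latticeBox 1 N := by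
    intro m hm
    have hm' := hK hm
    simp only [realBox, Set.mem_Icc] at hm'
    rw [latticeBox, Fintype.mem_piFinset]
    intro j
    have h1 := hm'.1 j
    have h2 := hm'.2 j
    simp only [realPoint] at h1 h2
    rw [Finset.mem_Icc]
    exact ⟨by exact_mod_cast h1, by exact_mod_cast h2⟩
  -- Step 1: each summand is a sum over `B` with an indicator on the translated point
  have step1 : ∀ H : ℤ, vonMangoldtSum (join Ψ (translate Ψ H)) (meetTranslate K H) N =
      ∑ n ∈ B, if realPoint (fun j => n j + H) ∈ K then f n * f (fun j => n j + H) else 0 := by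
    intro H
    unfold vonMangoldtSum
    rw [hB, Finset.sum_filter, Finset.sum_filter]
    refine Finset.sum_congr rfl fun n _ => ?_
    have hprod : ∏ i, intVonMangoldt ((join Ψ (translate Ψ H) i).eval n) =
        f n * f (fun j => n j + H) := by
      rw [prod_join]
      simp [hf, translate_eval]
    have hmem : (realPoint n ∈ meetTranslate K H) ↔
        (realPoint n ∈ K ∧ realPoint (fun j => n j + H) ∈ K) := by
      rw [realPoint_add]
      simp [meetTranslate]
    by_cases h1 : realPoint n ∈ K
    · by_cases h2 : realPoint (fun j => n j + H) ∈ K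
      · rw [if_pos (hmem.mpr ⟨h1, h2⟩), if_pos h1, if_pos h2, hprod]
      · rw [if_neg (fun h => h2 (hmem.mp h).2), if_pos h1, if_neg h2]
    · rw [if_neg (fun h => h1 (hmem.mp h).1), if_neg h1]
  simp_rw [step1]
  rw [Finset.sum_comm]
  -- Step 2: for fixed `n ∈ B`, the inner sum over `H` is `f n * ∑_{m ∈ B} f m`
  have step2 : ∀ n ∈ B, (∑ H ∈ Finset.Icc (-(2 * N : ℤ)) (2 * N),
      if realPoint (fun j => n j + H) ∈ K then f n * f (fun j => n j + H) else 0) =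
        f n * ∑ m ∈ B, f m := by
    intro n hn
    rw [← Finset.sum_filter, Finset.mul_sum]
    have hnbox : n ∈ latticeBox 1 N := (Finset.mem_filter.mp hn).1
    rw [latticeBox, Fintype.mem_piFinset] at hnbox
    have hn0 := Finset.mem_Icc.mp (hnbox 0)
    -- key: in dimension one, `n + (m 0 - n 0) = m`
    have hfun : ∀ m : Fin 1 → ℤ, (fun j => n j + (m 0 - n 0)) = m := by
      intro m
      funext j
      rw [Fin.fin_one_eq_zero j]
      ring
    refine Finset.sum_nbij' (fun H => fun j => n j + H) (fun m => m 0 - n 0) ?_ ?_ ?_ ?_ ?_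
    · intro H hH
      rw [Finset.mem_filter] at hH
      rw [hB, Finset.mem_filter]
      exact ⟨hbox _ hH.2, hH.2⟩
    · intro m hm
      rw [hB, Finset.mem_filter] at hm
      have hmbox := hm.1
      rw [latticeBox, Fintype.mem_piFinset] at hmbox
      have hm0 := Finset.mem_Icc.mp (hmbox 0)
      rw [Finset.mem_filter, Finset.mem_Icc]
      refine ⟨⟨by omega, by omega⟩, ?_⟩
      rw [hfun m]
      exact hm.2
    · intro H _
      show (n 0 + H) - n 0 = H
      ring
    · intro m _
      exact hfun m
    · intro H _
      rfl
  rw [Finset.sum_congr rfl step2, ← Finset.sum_mul, sq]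
  unfold vonMangoldtSum
  rw [hB]

/-- B2 — Gallagher averaging for translate-constellations (`m = 1`; singular products of the joined
systems, weighted by their archimedean factors, average to the square; the local factors multiply
EXACTLY on average over `H mod p`, the rest is the interchange of `∏_p` and `∑_H` as in the tree's
`GallagherSingularSeries.lean`). -/
def TranslateSingularMean : Prop :=
  ∀ (t L : ℕ), 1 ≤ t → ∀ ε : ℝ, 0 < ε → ∃ N₀ : ℕ, ∀ N : ℕ, N₀ ≤ N →
    ∀ Ψ : Fin t → AffLinForm 1, IsNondegenerateSystem Ψ → affLinSize Ψ N ≤ L →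
      ∀ K : Set (Fin 1 → ℝ), Convex ℝ K → K ⊆ realBox 1 N →
        |∑ H ∈ Finset.Icc (-(2 * N : ℤ)) (2 * N),
            archFactor (join Ψ (translate Ψ H)) (meetTranslate K H) *
              singularProduct (join Ψ (translate Ψ H))
          - (archFactor Ψ K * singularProduct Ψ) ^ 2| ≤ ε * (N : ℝ) ^ 2

/-- COARSE TWO-SIDED HARDY–LITTLEWOOD with sub-exponential dimension loss: some `g` with
`g(T)/T → 0` such that every non-degenerate `T`-system of size `≤ L` on a convex `K` of singular
mass `≥ η N` has `e^{-g(T)} M ≤ S ≤ e^{g(T)} M`. -/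
def CoarseHL : Prop :=
  ∃ g : ℕ → ℝ, Tendsto (fun T : ℕ => g T / T) atTop (𝓝 0) ∧
    ∀ (T L : ℕ), 1 ≤ T → ∀ η : ℝ, 0 < η → ∃ N₀ : ℕ, ∀ N : ℕ, N₀ ≤ N →
      ∀ Ψ : Fin T → AffLinForm 1, IsNondegenerateSystem Ψ → affLinSize Ψ N ≤ L →
        ∀ K : Set (Fin 1 → ℝ), Convex ℝ K → K ⊆ realBox 1 N →
          η * N ≤ archFactor Ψ K * singularProduct Ψ →
            Real.exp (-g T) * (archFactor Ψ K * singularProduct Ψ) ≤ vonMangoldtSum Ψ K N ∧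
              vonMangoldtSum Ψ K N ≤ Real.exp (g T) * (archFactor Ψ K * singularProduct Ψ)

/-- Its upper half alone. -/
def CoarseUpperHL : Prop :=
  ∃ g : ℕ → ℝ, Tendsto (fun T : ℕ => g T / T) atTop (𝓝 0) ∧
    ∀ (T L : ℕ), 1 ≤ T → ∀ η : ℝ, 0 < η → ∃ N₀ : ℕ, ∀ N : ℕ, N₀ ≤ N →
      ∀ Ψ : Fin T → AffLinForm 1, IsNondegenerateSystem Ψ → affLinSize Ψ N ≤ L →
        ∀ K : Set (Fin 1 → ℝ), Convex ℝ K → K ⊆ realBox 1 N →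
          η * N ≤ archFactor Ψ K * singularProduct Ψ →
            vonMangoldtSum Ψ K N ≤ Real.exp (g T) * (archFactor Ψ K * singularProduct Ψ)

/-- THE TRANSFER (B1 + B2 m-fold, crude upper-bound sieve for low-mass constellations, `(m+1)`-th
roots, `m → ∞`; then the low-mass regime of the crux by the upper-bound sieve). -/
def AmplificationTransfer : Prop := CoarseHL → RelativeDimOne

/-- The trivial converse: the transfer is an EQUIVALENCE. -/
def CoarseOfRelative : Prop := RelativeDimOne → CoarseHL

/-- Amplification of the upper half alone gives the SHARP uniform upper bound, which by Card A's
necessity (only upper bounds on `S_N(qk)` are used there) already forces `UniformCharPNT`: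
sub-exponential dimension dependence of prime-constellation upper bounds is Siegel-zero-hard. -/
def CoarseUpperIsSiegelHard : Prop := CoarseUpperHL → UniformCharPNT

end Summit.Parity.GeneralizedHardyLittlewood.Cruxes.RelativeDimOne.SketchIdeator1
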